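import Summits.Ventures.CertifiedManyBodySolver.Downfold.TPrimePinnedPairRow
import Summits.Ventures.CertifiedManyBodySolver.Downfold.BoxesLa214V115M2cBoxReadExt
import Literature.MathematicalPhysics.QuantumLattice.HubbardTTPrimeMeanEnergySupergradient
import HarnessLib

/-!
# The `t′`-PINNED PAIR at a station `U`, OBJECTIVE-FAMILY edition: SHAPE over `X : ℝ → FermionOp`, and the boxdual covariance law as a THEOREM
# under the objective CHORD hypothesis — PAIR ⇒ `TPrimeBundleOrbitLowerRowWN U s_A s_B lo hi F sl_A sl_B n₀ X` (captain trim (v), REV 2 companion)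

Venture CertifiedManyBodySolver; cell `hubbard-obs` / D-0154 (1)(C) COVERAGE; seat `hubbard-cov-ndnio2-box-1` (g2). Captain hubbard-cov-ndnio2-plan-1 g3 WORD «LAW FILE —
TRIM (v): OBJECTIVE FAMILY + CHORD HYPOTHESIS» (hubbard-obs STATUS 2026-08-28T19:46:25Z / 19:47:21Z, la214-box-2 g2's request): the density-affine `t′`-pair law of
record `Downfold/BoxReadPinnedPairTPrime.lean` (p662147, constant END objective `fun _ ↦ X₀`) stated over an objective FAMILY `X : ℝ → FermionOp (box 2 7)` — the
La214-M2(c) OWN-objective rows (`Oi`: `X = fun c ↦ −X₀(c, U)`) need the vertex objectives `X s_A`, `X s_B` and the row's `X s` related by hubbard-cov-la214-unc-2's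
CHORD condition (`Downfold/TPrimePinnedPairRow.lean` p661405 §C/§E: `(s_B − s)·X̄_{s_A} + (s − s_A)·X̄_{s_B} ≤ (s_B − s_A)·X̄_s` on translation-invariant states,
discharged BY NAME by `tPrimeObj_chord_const X₀ s_A s_B` for constant objectives and `tPrimeObj_chord_negOddMomentTT U s_A s_B` for the own f-sum word). This file is
kept SEPARATE only by the 400-line rule (rev 1 + the family edition do not fit one module); the rev-1 shape IS the `(fun _ ↦ X₀)` instance of this one
(`TPrimePinnedPairFamilyRowWN_iff_family`, `Iff.rfl`), so (B′) `Certificates/HubbardSquare_NdBoxE_n477o500_pairs_ABC_P.lean` (p662592) and every rev-1 caller are untouched.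

* §A `TPrimePinnedPairFamilyRowWN U s_A s_B c_A c_B fl_A fl_B β_A κ_A κ_A' sl_A β_B κ_B κ_B' sl_B n₀ X` — p662147 §A with `tPrimeObjOrbitMean X s_A ω` / `… X s_B ω` on the
  right (p661405 §A binders verbatim, plus the two vertex FILLING slopes and `∀ x ∈ [0, 2)`); `TPrimePinnedPairFamilyRowWN_iff_family`; `.reprice` / `.mono`.
* §C `TPrimePinnedPairFamilyRowWN.bundleWN`: p662147's law with the chord hypothesis `hX` used at the barycentre exactly as p661405 l.215 (`hXw`); kernel `K₂` box
  `1.6211390` (edition-free); corollaries `bundleWN_interior/_interior'/_vertex/_vertex'` (hg1201-box-1's `pinnedPair_segFloor_le`, unc-2's `tPrimePair_vertexFloor_le`,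
  cited by import) and `bundleWNT` (`.toWNT h`).

HONEST FRAMING: a claim SHAPE about states justified OUTSIDE Lean (two certsdp-cert/0 duals + `D₄`/translation averaging + pinfold verdict), NOT an SDP soundness
theorem; §C only moves the reader's arithmetic (F0, L, δ, floor kind, re-key) into the kernel once a PAIR node is typed. Nothing asserted: no node of record, CTL
object, tier, word or margin changes; «closed modulo nodes» ≠ proved. One-sided stiffness CEILINGS of CONTROL / CALIBRATION class (xx1) on SCREENING-GRADE downfolded
boxes; a ceiling never speaks to the presence or absence of superconductivity; no `T_c` / phase sentence; no item, rung leaf or summit statement is proved here. Zero compute.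

References: S. Boyd, L. Vandenberghe, *Convex Optimization* (2004) §5.9 [BoydVandenberghe2004]; T. Koma, H. Tasaki, J. Stat. Phys. 76 (1994) 745, §1
[KomaTasaki1994]; E. H. Lieb, M. Loss, Duke Math. J. 71 (1993) 337, §8 Thm. 8.2 [LiebLoss1993]; O. Bratteli, A. Kishimoto, D. W. Robinson,
Commun. Math. Phys. 64 (1978) 41, §3 [BratteliKishimotoRobinson1978].
-/

noncomputable section

namespace Summit.Ventures.CertifiedManyBodySolver.Downfold

open Set Filter Topology
open Literature.MathematicalPhysics.QuantumLattice Literature.MathematicalPhysics.QuantumLattice.ThermodynamicLimit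
open Literature.MathematicalPhysics.QuantumLattice.InfVolFermionState
open Literature.Probability.LatticeModels
open Matrix HubbardWave0
open scoped BigOperators ComplexOrder

/-! ## §A The pinned `t′`-pair claim-node SHAPE over an objective FAMILY (state level) -/

/-- **PINNED `t′`-PAIR SHAPE, OBJECTIVE-FAMILY EDITION `TPrimePinnedPairFamilyRowWN U s_A s_B c_A c_B fl_A fl_B β_A κ_A κ_A' sl_A β_B κ_B κ_B' sl_B n₀ X`** —
p662147's `TPrimePinnedPairFamilyRowWN` with the vertex objectives read from a family `X : ℝ → FermionOp (box 2 7)`: (V_A) bounds `tPrimeObjOrbitMean X s_A ω`, (V_B) bounds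
`tPrimeObjOrbitMean X s_B ω` (hub / pinned-spoke certificate: bound β_v, cap-row multiplier κ_v ≥ 0 on `e_{Φ(1,s_v,U)}(ω) ≤ c_v`, cut-row multiplier κ_v' ≥ 0 on
`fl_v ≤ e_{Φ(1,s_v,U)}(ω)`, filling slope sl_v, shared pinned eom functionals E₀, E₁ with (E) `E₀ ω + s·E₁ ω = 0` on ground states at `s`). A claim SHAPE about
states justified outside Lean (two certsdp duals + `D₄`/translation averaging + pinfold verdict), NOT an SDP soundness theorem; no node of record / CTL object / word /
margin changes. [cite: BoydVandenberghe2004, §5.9] -/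
def TPrimePinnedPairFamilyRowWN (U sA sB : ℝ) (cA cB flA flB βA κA κA' slA βB κB κB' slB n₀ : ℚ)
    (X : ℝ → FermionOp (Literature.Probability.LatticeModels.box 2 7)) : Prop :=
  ∃ E₀ E₁ : InfVolFermionState 2 → ℝ,
    ∀ s ∈ Set.Icc sA sB, ∀ x : ℝ, 0 ≤ x → x < 2 →
      ∀ (ω : InfVolFermionState 2) (Ls : ℕ → ℕ) (ψ : ∀ L, Fock (Orb (FermionTorus 2 L))),
        Tendsto Ls atTop atTop →
        (∀ j, IsGroundStateInSector (hubbardTorusTT' (Ls j) 1 s U) (rectN x (Ls j)) 0 (ψ (Ls j))) →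
        (∀ j, star (ψ (Ls j)) ⬝ᵥ ψ (Ls j) = 1) → ω.IsTorusLimitOf ψ Ls →
        (E₀ ω + s * E₁ ω = 0) ∧
        (((βA : ℚ) : ℝ) + ((κA : ℚ) : ℝ) * (((cA : ℚ) : ℝ) - ω.meanEnergy (hubbardTTPrimeFermionInteraction 1 sA U) 1) +
            ((κA' : ℚ) : ℝ) * (ω.meanEnergy (hubbardTTPrimeFermionInteraction 1 sA U) 1 - ((flA : ℚ) : ℝ)) +
            ((slA : ℚ) : ℝ) * (x - ((n₀ : ℚ) : ℝ)) + E₀ ω + sA * E₁ ω ≤ tPrimeObjOrbitMean X sA ω) ∧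
        (((βB : ℚ) : ℝ) + ((κB : ℚ) : ℝ) * (((cB : ℚ) : ℝ) - ω.meanEnergy (hubbardTTPrimeFermionInteraction 1 sB U) 1) +
            ((κB' : ℚ) : ℝ) * (ω.meanEnergy (hubbardTTPrimeFermionInteraction 1 sB U) 1 - ((flB : ℚ) : ℝ)) +
            ((slB : ℚ) : ℝ) * (x - ((n₀ : ℚ) : ℝ)) + E₀ ω + sB * E₁ ω ≤ tPrimeObjOrbitMean X sB ω)


/-! ## §A′ Solver-free edges: affinity re-key and slot monotonicity (as in rev 1) -/

section PairEdges
variable {U sA sB : ℝ} {cA cB flA flB βA κA κA' slA βB κB κB' slB n₀ : ℚ}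
  {X : ℝ → FermionOp (Literature.Probability.LatticeModels.box 2 7)}

/-- **AFFINITY RE-KEY is an identity of the pair** (captain D10/D16 «re-key by affinity»; box-2 `--rekey`): moving both cap literals `c_v ↦ c_v″` while shifting
`β_v ↦ β_v − κ_v·(c_v″ − c_v)` leaves (V_A), (V_B) literally unchanged — so ONE pair node serves every cap tier. [cite: BoydVandenberghe2004, §5.9] -/
theorem TPrimePinnedPairFamilyRowWN.reprice
    (h : TPrimePinnedPairFamilyRowWN U sA sB cA cB flA flB βA κA κA' slA βB κB κB' slB n₀ X) (cA'' cB'' : ℚ) :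
    TPrimePinnedPairFamilyRowWN U sA sB cA'' cB'' flA flB (βA - κA * (cA'' - cA)) κA κA' slA (βB - κB * (cB'' - cB)) κB κB' slB n₀ X := by
  obtain ⟨E₀, E₁, hP⟩ := h
  refine ⟨E₀, E₁, fun s hs x hx0 hx2 ω Ls ψ hLs hψ h1 hω => ?_⟩
  obtain ⟨hE, hVA, hVB⟩ := hP s hs x hx0 hx2 ω Ls ψ hLs hψ h1 hω
  refine ⟨hE, ?_, ?_⟩
  · have e : (((βA - κA * (cA'' - cA) : ℚ)) : ℝ) + ((κA : ℚ) : ℝ) * (((cA'' : ℚ) : ℝ) - ω.meanEnergy (hubbardTTPrimeFermionInteraction 1 sA U) 1) =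
        ((βA : ℚ) : ℝ) + ((κA : ℚ) : ℝ) * (((cA : ℚ) : ℝ) - ω.meanEnergy (hubbardTTPrimeFermionInteraction 1 sA U) 1) := by
      push_cast; ring
    linarith
  · have e : (((βB - κB * (cB'' - cB) : ℚ)) : ℝ) + ((κB : ℚ) : ℝ) * (((cB'' : ℚ) : ℝ) - ω.meanEnergy (hubbardTTPrimeFermionInteraction 1 sB U) 1) =
        ((βB : ℚ) : ℝ) + ((κB : ℚ) : ℝ) * (((cB : ℚ) : ℝ) - ω.meanEnergy (hubbardTTPrimeFermionInteraction 1 sB U) 1) := by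
      push_cast; ring
    linarith

/-- Slot monotonicity of the pair: smaller vertex bounds `β_v′ ≤ β_v` are still certified. [folklore] -/
theorem TPrimePinnedPairFamilyRowWN.mono
    (h : TPrimePinnedPairFamilyRowWN U sA sB cA cB flA flB βA κA κA' slA βB κB κB' slB n₀ X) {βA₁ βB₁ : ℚ} (hA : βA₁ ≤ βA) (hB : βB₁ ≤ βB) :
    TPrimePinnedPairFamilyRowWN U sA sB cA cB flA flB βA₁ κA κA' slA βB₁ κB κB' slB n₀ X := by
  obtain ⟨E₀, E₁, hP⟩ := h
  refine ⟨E₀, E₁, fun s hs x hx0 hx2 ω Ls ψ hLs hψ h1 hω => ?_⟩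
  obtain ⟨hE, hVA, hVB⟩ := hP s hs x hx0 hx2 ω Ls ψ hLs hψ h1 hω
  have hA' : ((βA₁ : ℚ) : ℝ) ≤ ((βA : ℚ) : ℝ) := by exact_mod_cast hA
  have hB' : ((βB₁ : ℚ) : ℝ) ≤ ((βB : ℚ) : ℝ) := by exact_mod_cast hB
  exact ⟨hE, by linarith, by linarith⟩

end PairEdges
/-! ## §C PAIR ⇒ bundle row on the whole segment: the covariance law as a theorem -/

section Law
variable {U sA sB : ℝ} {cA cB flA flB βA κA κA' slA βB κB κB' slB n₀ : ℚ}
  {X : ℝ → FermionOp (Literature.Probability.LatticeModels.box 2 7)}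

/-- **THE BOXDUAL COVARIANCE LAW, OBJECTIVE-FAMILY EDITION (pinned `t′`-pair ⇒ density-affine bundle row).** From the PAIR shape, the objective CHORD
hypothesis `hX` (p661405 §C; `tPrimeObj_chord_const` / `tPrimeObj_chord_negOddMomentTT` discharge it by name), `0 ≤ U`, `s_A < s_B`, non-negative window
multipliers, bundle window literals under the vertex rows (`hi ≤ c_A`, `hi ≤ c_B`, `fl_A ≤ lo`, `fl_B ≤ lo`), any `L` dominating the covariance constant
`1.6211390·(s_B − s_A)·|(κ_A − κ_A') − (κ_B − κ_B')|` (stated as the two sign cases `hL₁`/`hL₂`, decidable on literals; the kinematic `K₂` row prices the cross term)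
and any slot `F` under `(1 − w)β_A + wβ_B − w(1 − w)L` on `[0, 1]`: the reader's row `TPrimeBundleOrbitLowerRowWN U s_A s_B lo hi F sl_A sl_B n₀ X`. [cite: BoydVandenberghe2004, §5.9] [cite: KomaTasaki1994, §1]
[cite: LiebLoss1993, §8, Theorem 8.2] -/
theorem TPrimePinnedPairFamilyRowWN.bundleWN
    (h : TPrimePinnedPairFamilyRowWN U sA sB cA cB flA flB βA κA κA' slA βB κB κB' slB n₀ X)
    (hU : 0 ≤ U) (hAB : sA < sB) (hκA : 0 ≤ κA) (hκA' : 0 ≤ κA') (hκB : 0 ≤ κB) (hκB' : 0 ≤ κB')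
    {lo hi F L : ℚ} (hcA : hi ≤ cA) (hcB : hi ≤ cB) (hfA : flA ≤ lo) (hfB : flB ≤ lo)
    (hL₁ : (1.6211390 : ℝ) * (sB - sA) * (((κA - κA' - (κB - κB') : ℚ)) : ℝ) ≤ ((L : ℚ) : ℝ))
    (hL₂ : (1.6211390 : ℝ) * (sB - sA) * -(((κA - κA' - (κB - κB') : ℚ)) : ℝ) ≤ ((L : ℚ) : ℝ))
    (hX : ∀ ω : InfVolFermionState 2, ω.IsTranslationInvariant → ∀ s ∈ Set.Icc sA sB,
      (sB - s) * tPrimeObjOrbitMean X sA ω + (s - sA) * tPrimeObjOrbitMean X sB ω ≤ (sB - sA) * tPrimeObjOrbitMean X s ω)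
    (hF : ∀ w ∈ Set.Icc (0 : ℝ) 1, ((F : ℚ) : ℝ) ≤ (1 - w) * ((βA : ℚ) : ℝ) + w * ((βB : ℚ) : ℝ) - w * (1 - w) * ((L : ℚ) : ℝ)) :
    TPrimeBundleOrbitLowerRowWN U sA sB lo hi F slA slB n₀ X := by
  have hL : (1.6211390 : ℝ) * (sB - sA) * |(((κA - κA' - (κB - κB') : ℚ)) : ℝ)| ≤ ((L : ℚ) : ℝ) := by
    rcases le_total 0 ((((κA - κA' - (κB - κB') : ℚ)) : ℝ)) with hD | hD
    · rwa [abs_of_nonneg hD]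
    · rwa [abs_of_nonpos hD]
  intro s hs x hx0 hx2 ω Ls ψ hLs hψ h1 hω hlo hhi
  obtain ⟨E₀, E₁, hP⟩ := h
  obtain ⟨hE, hVA, hVB⟩ := hP s hs x hx0 hx2 ω Ls ψ hLs hψ h1 hω
  show wnBundleValue F slA slB n₀ x ≤ tPrimeObjOrbitMean X s ω
  -- the kinematic `K₂` row and the anchor energies of `ω`
  have hN : ∀ j, IsNParticle (rectN x (Ls j)) (ψ (Ls j)) := fun j =>
    ((mem_szSector_iff _ _ _).1 (hψ j).1).1
  have hK : |ω.meanEnergy (hubbardTTPrimeFermionInteraction 0 1 0) 1| ≤ (1.6211390 : ℝ) :=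
    hω.abs_meanEnergy_diagHop_le_decimal hx0 hx2 hLs hN h1
  have hGS : ω.meanEnergy (hubbardTTPrimeFermionInteraction 1 s U) 1 = energyDensityTT' 1 s U x :=
    hω.meanEnergy_hubbardTTPrime_eq_energyDensityTT' 1 s hU hx0 hx2 hLs hψ h1
  have hEA : ω.meanEnergy (hubbardTTPrimeFermionInteraction 1 sA U) 1 =
      energyDensityTT' 1 s U x + (sA - s) * ω.meanEnergy (hubbardTTPrimeFermionInteraction 0 1 0) 1 := by
    rw [ω.meanEnergy_hubbardTTPrime_affine 1 s U sA U, hGS]; ring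
  have hEB : ω.meanEnergy (hubbardTTPrimeFermionInteraction 1 sB U) 1 =
      energyDensityTT' 1 s U x + (sB - s) * ω.meanEnergy (hubbardTTPrimeFermionInteraction 0 1 0) 1 := by
    rw [ω.meanEnergy_hubbardTTPrime_affine 1 s U sB U, hGS]; ring
  rw [hEA] at hVA
  rw [hEB] at hVB
  -- plain real names for the state functionals
  generalize hKdef : ω.meanEnergy (hubbardTTPrimeFermionInteraction 0 1 0) 1 = K at hK hVA hVB
  generalize hedef : energyDensityTT' 1 s U x = e at hlo hhi hVA hVB
  generalize hE₀def : E₀ ω = a₀ at hE hVA hVB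
  generalize hE₁def : E₁ ω = a₁ at hE hVA hVB
  -- the barycentric coordinate of `s`
  have hΔ : 0 < sB - sA := sub_pos.2 hAB
  obtain ⟨w, hw0, hw1, hsw⟩ : ∃ w : ℝ, 0 ≤ w ∧ w ≤ 1 ∧ s - sA = w * (sB - sA) :=
    ⟨(s - sA) / (sB - sA), div_nonneg (sub_nonneg.2 hs.1) hΔ.le, (div_le_one hΔ).2 (by linarith [hs.2]),
      (div_mul_cancel₀ _ (ne_of_gt hΔ)).symm⟩
  have h1w : 0 ≤ 1 - w := sub_nonneg.2 hw1
  have hsA : sA - s = -(w * (sB - sA)) := by linarith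
  have hsB : sB - s = (1 - w) * (sB - sA) := by linarith
  -- the objective chord at the barycentre (p661405 `hXw`), on the translation-invariant torus limit
  have hXw : (1 - w) * tPrimeObjOrbitMean X sA ω + w * tPrimeObjOrbitMean X sB ω ≤ tPrimeObjOrbitMean X s ω := by
    have h' := hX ω hω.isTranslationInvariant s hs
    rw [hsB, hsw] at h'
    exact le_of_mul_le_mul_left (h'.trans' (le_of_eq (by ring))) hΔ
  generalize hXAdef : tPrimeObjOrbitMean X sA ω = XA at hVA hXw
  generalize hXBdef : tPrimeObjOrbitMean X sB ω = XB at hVB hXw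
  generalize hXsdef : tPrimeObjOrbitMean X s ω = Xs at hXw ⊢
  rw [hsA] at hVA
  rw [hsB] at hVB
  -- casts of the rational side conditions
  have hcA' : ((hi : ℚ) : ℝ) ≤ ((cA : ℚ) : ℝ) := by exact_mod_cast hcA
  have hcB' : ((hi : ℚ) : ℝ) ≤ ((cB : ℚ) : ℝ) := by exact_mod_cast hcB
  have hfA' : ((flA : ℚ) : ℝ) ≤ ((lo : ℚ) : ℝ) := by exact_mod_cast hfA
  have hfB' : ((flB : ℚ) : ℝ) ≤ ((lo : ℚ) : ℝ) := by exact_mod_cast hfB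
  have hκA0 : (0 : ℝ) ≤ ((κA : ℚ) : ℝ) := by exact_mod_cast hκA
  have hκA0' : (0 : ℝ) ≤ ((κA' : ℚ) : ℝ) := by exact_mod_cast hκA'
  have hκB0 : (0 : ℝ) ≤ ((κB : ℚ) : ℝ) := by exact_mod_cast hκB
  have hκB0' : (0 : ℝ) ≤ ((κB' : ℚ) : ℝ) := by exact_mod_cast hκB'
  have hΔκ : (((κA - κA' - (κB - κB') : ℚ)) : ℝ) =
      ((κA : ℚ) : ℝ) - ((κA' : ℚ) : ℝ) - (((κB : ℚ) : ℝ) - ((κB' : ℚ) : ℝ)) := by push_cast; ring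
  generalize hDdef : (((κA - κA' - (κB - κB') : ℚ)) : ℝ) = D at hL hΔκ
  -- (1) multipliers × window slacks ≥ 0 (the bundle window `lo ≤ e ≤ hi` sits inside both vertex windows)
  have P1 : 0 ≤ (1 - w) * (((κA : ℚ) : ℝ) * (((cA : ℚ) : ℝ) - e)) :=
    mul_nonneg h1w (mul_nonneg hκA0 (by linarith))
  have P2 : 0 ≤ (1 - w) * (((κA' : ℚ) : ℝ) * (e - ((flA : ℚ) : ℝ))) :=
    mul_nonneg h1w (mul_nonneg hκA0' (by linarith))
  have P3 : 0 ≤ w * (((κB : ℚ) : ℝ) * (((cB : ℚ) : ℝ) - e)) :=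
    mul_nonneg hw0 (mul_nonneg hκB0 (by linarith))
  have P4 : 0 ≤ w * (((κB' : ℚ) : ℝ) * (e - ((flB : ℚ) : ℝ))) :=
    mul_nonneg hw0 (mul_nonneg hκB0' (by linarith))
  -- (2) the covariance term, priced on the kinematic `K₂` row
  have hDK : |D * K| ≤ |D| * 1.6211390 := by
    rw [abs_mul]; exact mul_le_mul_of_nonneg_left hK (abs_nonneg _)
  have h0 : -(|D| * (1.6211390 : ℝ)) ≤ D * K := by
    have := neg_abs_le (D * K)
    linarith
  have hcov1 : (sB - sA) * (-(|D| * (1.6211390 : ℝ))) ≤ (sB - sA) * (D * K) :=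
    mul_le_mul_of_nonneg_left h0 hΔ.le
  have e1 : (sB - sA) * (-(|D| * (1.6211390 : ℝ))) = -((1.6211390 : ℝ) * (sB - sA) * |D|) := by ring
  have hcov0 : -((L : ℚ) : ℝ) ≤ (sB - sA) * (D * K) := by linarith
  have hw01 : 0 ≤ w * (1 - w) := mul_nonneg hw0 h1w
  have hcov2 : w * (1 - w) * (-((L : ℚ) : ℝ)) ≤ w * (1 - w) * ((sB - sA) * (D * K)) :=
    mul_le_mul_of_nonneg_left hcov0 hw01
  have e2 : w * (1 - w) * (-((L : ℚ) : ℝ)) = -(w * (1 - w) * ((L : ℚ) : ℝ)) := by ring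
  have P5 : -(w * (1 - w) * ((L : ℚ) : ℝ)) ≤ w * (1 - w) * ((sB - sA) * (D * K)) := by linarith
  -- (3) the combined filling slope dominates the `min`
  have P6 : min (((slA : ℚ) : ℝ) * (x - ((n₀ : ℚ) : ℝ))) (((slB : ℚ) : ℝ) * (x - ((n₀ : ℚ) : ℝ))) ≤
      (1 - w) * (((slA : ℚ) : ℝ) * (x - ((n₀ : ℚ) : ℝ))) + w * (((slB : ℚ) : ℝ) * (x - ((n₀ : ℚ) : ℝ))) := by
    have a1 := mul_le_mul_of_nonneg_left (min_le_left (((slA : ℚ) : ℝ) * (x - ((n₀ : ℚ) : ℝ)))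
      (((slB : ℚ) : ℝ) * (x - ((n₀ : ℚ) : ℝ)))) h1w
    have a2 := mul_le_mul_of_nonneg_left (min_le_right (((slA : ℚ) : ℝ) * (x - ((n₀ : ℚ) : ℝ)))
      (((slB : ℚ) : ℝ) * (x - ((n₀ : ℚ) : ℝ)))) hw0
    linarith
  have P7 := hF w ⟨hw0, hw1⟩  -- (4) the slot under the Bernstein floor; (5) the barycentric combination:
  have hVA' := mul_le_mul_of_nonneg_left hVA h1w
  have hVB' := mul_le_mul_of_nonneg_left hVB hw0
  have hEw : (1 - w) * (a₀ + sA * a₁) + w * (a₀ + sB * a₁) = 0 := by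
    have hs' : (1 - w) * sA + w * sB = s := by linarith
    calc (1 - w) * (a₀ + sA * a₁) + w * (a₀ + sB * a₁)
        = a₀ + ((1 - w) * sA + w * sB) * a₁ := by ring
      _ = 0 := by rw [hs']; exact hE
  have key :
      (1 - w) * (((βA : ℚ) : ℝ) + ((κA : ℚ) : ℝ) * (((cA : ℚ) : ℝ) - (e + -(w * (sB - sA)) * K)) +
          ((κA' : ℚ) : ℝ) * (e + -(w * (sB - sA)) * K - ((flA : ℚ) : ℝ)) +
          ((slA : ℚ) : ℝ) * (x - ((n₀ : ℚ) : ℝ)) + a₀ + sA * a₁) +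
        w * (((βB : ℚ) : ℝ) + ((κB : ℚ) : ℝ) * (((cB : ℚ) : ℝ) - (e + (1 - w) * (sB - sA) * K)) +
          ((κB' : ℚ) : ℝ) * (e + (1 - w) * (sB - sA) * K - ((flB : ℚ) : ℝ)) +
          ((slB : ℚ) : ℝ) * (x - ((n₀ : ℚ) : ℝ)) + a₀ + sB * a₁) =
      ((1 - w) * ((βA : ℚ) : ℝ) + w * ((βB : ℚ) : ℝ)) +
        ((1 - w) * (((slA : ℚ) : ℝ) * (x - ((n₀ : ℚ) : ℝ))) + w * (((slB : ℚ) : ℝ) * (x - ((n₀ : ℚ) : ℝ)))) +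
        ((1 - w) * (((κA : ℚ) : ℝ) * (((cA : ℚ) : ℝ) - e)) + (1 - w) * (((κA' : ℚ) : ℝ) * (e - ((flA : ℚ) : ℝ))) +
          w * (((κB : ℚ) : ℝ) * (((cB : ℚ) : ℝ) - e)) + w * (((κB' : ℚ) : ℝ) * (e - ((flB : ℚ) : ℝ)))) +
        w * (1 - w) * ((sB - sA) * ((((κA : ℚ) : ℝ) - ((κA' : ℚ) : ℝ) - (((κB : ℚ) : ℝ) - ((κB' : ℚ) : ℝ))) * K)) +
        ((1 - w) * (a₀ + sA * a₁) + w * (a₀ + sB * a₁)) := by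
    ring
  rw [← hΔκ] at key
  unfold wnBundleValue
  linarith [hVA', hVB', key, hEw, hXw, P1, P2, P3, P4, P5, P6, P7]

/-- **Interior kind, hub-anchored floor** (`0 < L`): the reader's `F0 = β_A − (L − (β_B − β_A))²/(4L)` (`pinnedPair_segFloor_le`: below the parabola for every gap; the exact
minimum when `|β_B − β_A| ≤ L`); any `F ≤ F0` gives the bundle row — every side goal a rational inequality. [cite: BoydVandenberghe2004, §5.9] -/
theorem TPrimePinnedPairFamilyRowWN.bundleWN_interior
    (h : TPrimePinnedPairFamilyRowWN U sA sB cA cB flA flB βA κA κA' slA βB κB κB' slB n₀ X)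
    (hU : 0 ≤ U) (hAB : sA < sB) (hκA : 0 ≤ κA) (hκA' : 0 ≤ κA') (hκB : 0 ≤ κB) (hκB' : 0 ≤ κB')
    {lo hi F L : ℚ} (hcA : hi ≤ cA) (hcB : hi ≤ cB) (hfA : flA ≤ lo) (hfB : flB ≤ lo)
    (hL₁ : (1.6211390 : ℝ) * (sB - sA) * (((κA - κA' - (κB - κB') : ℚ)) : ℝ) ≤ ((L : ℚ) : ℝ))
    (hL₂ : (1.6211390 : ℝ) * (sB - sA) * -(((κA - κA' - (κB - κB') : ℚ)) : ℝ) ≤ ((L : ℚ) : ℝ))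
    (hX : ∀ ω : InfVolFermionState 2, ω.IsTranslationInvariant → ∀ s ∈ Set.Icc sA sB,
      (sB - s) * tPrimeObjOrbitMean X sA ω + (s - sA) * tPrimeObjOrbitMean X sB ω ≤ (sB - sA) * tPrimeObjOrbitMean X s ω)
    (hL0 : 0 < L) (hF : F ≤ βA - (L - (βB - βA)) ^ 2 / (4 * L)) :
    TPrimeBundleOrbitLowerRowWN U sA sB lo hi F slA slB n₀ X := by
  refine h.bundleWN hU hAB hκA hκA' hκB hκB' hcA hcB hfA hfB hL₁ hL₂ hX fun w _ => ?_
  have hF' : ((F : ℚ) : ℝ) ≤ ((βA : ℚ) : ℝ) - (((L : ℚ) : ℝ) - (((βB : ℚ) : ℝ) - ((βA : ℚ) : ℝ))) ^ 2 / (4 * ((L : ℚ) : ℝ)) := by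
    have := (Rat.cast_le (K := ℝ)).2 hF
    push_cast at this
    exact this
  exact hF'.trans (pinnedPair_segFloor_le _ _ _ w (by exact_mod_cast hL0))

/-- **Interior kind, spoke-anchored floor** (`0 < L`): `F0 = β_B − (L − (β_A − β_B))²/(4L)` (the same parabola read from the other end). [cite: BoydVandenberghe2004, §5.9] -/
theorem TPrimePinnedPairFamilyRowWN.bundleWN_interior'
    (h : TPrimePinnedPairFamilyRowWN U sA sB cA cB flA flB βA κA κA' slA βB κB κB' slB n₀ X)
    (hU : 0 ≤ U) (hAB : sA < sB) (hκA : 0 ≤ κA) (hκA' : 0 ≤ κA') (hκB : 0 ≤ κB) (hκB' : 0 ≤ κB')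
    {lo hi F L : ℚ} (hcA : hi ≤ cA) (hcB : hi ≤ cB) (hfA : flA ≤ lo) (hfB : flB ≤ lo)
    (hL₁ : (1.6211390 : ℝ) * (sB - sA) * (((κA - κA' - (κB - κB') : ℚ)) : ℝ) ≤ ((L : ℚ) : ℝ))
    (hL₂ : (1.6211390 : ℝ) * (sB - sA) * -(((κA - κA' - (κB - κB') : ℚ)) : ℝ) ≤ ((L : ℚ) : ℝ))
    (hX : ∀ ω : InfVolFermionState 2, ω.IsTranslationInvariant → ∀ s ∈ Set.Icc sA sB,
      (sB - s) * tPrimeObjOrbitMean X sA ω + (s - sA) * tPrimeObjOrbitMean X sB ω ≤ (sB - sA) * tPrimeObjOrbitMean X s ω)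
    (hL0 : 0 < L) (hF : F ≤ βB - (L - (βA - βB)) ^ 2 / (4 * L)) :
    TPrimeBundleOrbitLowerRowWN U sA sB lo hi F slA slB n₀ X := by
  refine h.bundleWN hU hAB hκA hκA' hκB hκB' hcA hcB hfA hfB hL₁ hL₂ hX fun w _ => ?_
  have hF' : ((F : ℚ) : ℝ) ≤ ((βB : ℚ) : ℝ) - (((L : ℚ) : ℝ) - (((βA : ℚ) : ℝ) - ((βB : ℚ) : ℝ))) ^ 2 / (4 * ((L : ℚ) : ℝ)) := by
    have := (Rat.cast_le (K := ℝ)).2 hF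
    push_cast at this
    exact this
  have key := pinnedPair_segFloor_le ((βB : ℚ) : ℝ) ((βA : ℚ) : ℝ) ((L : ℚ) : ℝ) (1 - w) (by exact_mod_cast hL0)
  have e : (1 - (1 - w)) * ((βB : ℚ) : ℝ) + (1 - w) * ((βA : ℚ) : ℝ) - (1 - w) * (1 - (1 - w)) * ((L : ℚ) : ℝ) =
      (1 - w) * ((βA : ℚ) : ℝ) + w * ((βB : ℚ) : ℝ) - w * (1 - w) * ((L : ℚ) : ℝ) := by ring
  linarith

/-- **Vertex kind, hub below spoke** (`0 ≤ L`, `β_A + L ≤ β_B`): the floor is the hub bound — any `F ≤ β_A` gives the bundle row (`tPrimePair_vertexFloor_le`).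
[cite: BoydVandenberghe2004, §5.9] -/
theorem TPrimePinnedPairFamilyRowWN.bundleWN_vertex
    (h : TPrimePinnedPairFamilyRowWN U sA sB cA cB flA flB βA κA κA' slA βB κB κB' slB n₀ X)
    (hU : 0 ≤ U) (hAB : sA < sB) (hκA : 0 ≤ κA) (hκA' : 0 ≤ κA') (hκB : 0 ≤ κB) (hκB' : 0 ≤ κB')
    {lo hi F L : ℚ} (hcA : hi ≤ cA) (hcB : hi ≤ cB) (hfA : flA ≤ lo) (hfB : flB ≤ lo)
    (hL₁ : (1.6211390 : ℝ) * (sB - sA) * (((κA - κA' - (κB - κB') : ℚ)) : ℝ) ≤ ((L : ℚ) : ℝ))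
    (hL₂ : (1.6211390 : ℝ) * (sB - sA) * -(((κA - κA' - (κB - κB') : ℚ)) : ℝ) ≤ ((L : ℚ) : ℝ))
    (hX : ∀ ω : InfVolFermionState 2, ω.IsTranslationInvariant → ∀ s ∈ Set.Icc sA sB,
      (sB - s) * tPrimeObjOrbitMean X sA ω + (s - sA) * tPrimeObjOrbitMean X sB ω ≤ (sB - sA) * tPrimeObjOrbitMean X s ω)
    (hL0 : 0 ≤ L) (hg : βA + L ≤ βB) (hF : F ≤ βA) :
    TPrimeBundleOrbitLowerRowWN U sA sB lo hi F slA slB n₀ X := by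
  refine h.bundleWN hU hAB hκA hκA' hκB hκB' hcA hcB hfA hfB hL₁ hL₂ hX fun w hw => ?_
  have hF' : ((F : ℚ) : ℝ) ≤ ((βA : ℚ) : ℝ) := by exact_mod_cast hF
  have hg' : ((βA : ℚ) : ℝ) + ((L : ℚ) : ℝ) ≤ ((βB : ℚ) : ℝ) := by exact_mod_cast hg
  have key := tPrimePair_vertexFloor_le ((βA : ℚ) : ℝ) ((βB : ℚ) : ℝ) ((L : ℚ) : ℝ) w (by exact_mod_cast hL0)
    (by rw [abs_of_nonneg (by linarith)]; linarith) hw.1 hw.2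
  rw [min_eq_left (by linarith : ((βA : ℚ) : ℝ) ≤ ((βB : ℚ) : ℝ))] at key
  exact hF'.trans key

/-- **Vertex kind, spoke below hub** (`0 ≤ L`, `β_B + L ≤ β_A`): any `F ≤ β_B` gives the bundle row. [cite: BoydVandenberghe2004, §5.9] -/
theorem TPrimePinnedPairFamilyRowWN.bundleWN_vertex'
    (h : TPrimePinnedPairFamilyRowWN U sA sB cA cB flA flB βA κA κA' slA βB κB κB' slB n₀ X)
    (hU : 0 ≤ U) (hAB : sA < sB) (hκA : 0 ≤ κA) (hκA' : 0 ≤ κA') (hκB : 0 ≤ κB) (hκB' : 0 ≤ κB')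
    {lo hi F L : ℚ} (hcA : hi ≤ cA) (hcB : hi ≤ cB) (hfA : flA ≤ lo) (hfB : flB ≤ lo)
    (hL₁ : (1.6211390 : ℝ) * (sB - sA) * (((κA - κA' - (κB - κB') : ℚ)) : ℝ) ≤ ((L : ℚ) : ℝ))
    (hL₂ : (1.6211390 : ℝ) * (sB - sA) * -(((κA - κA' - (κB - κB') : ℚ)) : ℝ) ≤ ((L : ℚ) : ℝ))
    (hX : ∀ ω : InfVolFermionState 2, ω.IsTranslationInvariant → ∀ s ∈ Set.Icc sA sB,
      (sB - s) * tPrimeObjOrbitMean X sA ω + (s - sA) * tPrimeObjOrbitMean X sB ω ≤ (sB - sA) * tPrimeObjOrbitMean X s ω)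
    (hL0 : 0 ≤ L) (hg : βB + L ≤ βA) (hF : F ≤ βB) :
    TPrimeBundleOrbitLowerRowWN U sA sB lo hi F slA slB n₀ X := by
  refine h.bundleWN hU hAB hκA hκA' hκB hκB' hcA hcB hfA hfB hL₁ hL₂ hX fun w hw => ?_
  have hF' : ((F : ℚ) : ℝ) ≤ ((βB : ℚ) : ℝ) := by exact_mod_cast hF
  have hg' : ((βB : ℚ) : ℝ) + ((L : ℚ) : ℝ) ≤ ((βA : ℚ) : ℝ) := by exact_mod_cast hg
  have key := tPrimePair_vertexFloor_le ((βA : ℚ) : ℝ) ((βB : ℚ) : ℝ) ((L : ℚ) : ℝ) w (by exact_mod_cast hL0)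
    (by rw [abs_of_nonpos (by linarith)]; linarith) hw.1 hw.2
  rw [min_eq_right (by linarith : ((βB : ℚ) : ℝ) ≤ ((βA : ℚ) : ℝ))] at key
  exact hF'.trans key

/-- **T′-BOX editions (e1 / e2)**: every row so obtained is also a `TPrimeBundleOrbitLowerRowWNT … h …` row for EVERY letter box `h` (the letter premise is
simply not used — the covariance term was priced on the kinematic `K₂` row, which every declared box `h ≥ 2027/10⁴` contains). [cite: LiebLoss1993, §8, Theorem 8.2] -/
theorem TPrimePinnedPairFamilyRowWN.bundleWNT
    (h : TPrimePinnedPairFamilyRowWN U sA sB cA cB flA flB βA κA κA' slA βB κB κB' slB n₀ X)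
    (hU : 0 ≤ U) (hAB : sA < sB) (hκA : 0 ≤ κA) (hκA' : 0 ≤ κA') (hκB : 0 ≤ κB) (hκB' : 0 ≤ κB')
    {lo hi F L : ℚ} (hcA : hi ≤ cA) (hcB : hi ≤ cB) (hfA : flA ≤ lo) (hfB : flB ≤ lo)
    (hL₁ : (1.6211390 : ℝ) * (sB - sA) * (((κA - κA' - (κB - κB') : ℚ)) : ℝ) ≤ ((L : ℚ) : ℝ))
    (hL₂ : (1.6211390 : ℝ) * (sB - sA) * -(((κA - κA' - (κB - κB') : ℚ)) : ℝ) ≤ ((L : ℚ) : ℝ))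
    (hX : ∀ ω : InfVolFermionState 2, ω.IsTranslationInvariant → ∀ s ∈ Set.Icc sA sB,
      (sB - s) * tPrimeObjOrbitMean X sA ω + (s - sA) * tPrimeObjOrbitMean X sB ω ≤ (sB - sA) * tPrimeObjOrbitMean X s ω)
    (hF : ∀ w ∈ Set.Icc (0 : ℝ) 1, ((F : ℚ) : ℝ) ≤ (1 - w) * ((βA : ℚ) : ℝ) + w * ((βB : ℚ) : ℝ) - w * (1 - w) * ((L : ℚ) : ℝ))
    (hbox : ℚ) :
    TPrimeBundleOrbitLowerRowWNT U sA sB lo hi hbox F slA slB n₀ X :=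
  (h.bundleWN hU hAB hκA hκA' hκB hκB' hcA hcB hfA hfB hL₁ hL₂ hX hF).toWNT hbox

end Law
end Summit.Ventures.CertifiedManyBodySolver.Downfold
end
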